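import Summits.CriticalPhenomena.PercolationContinuityZ3.Theorems.PercNearOneGluingNoHeavyLowerTailSahiPolyReflectFast
import HarnessLib

/-!
# `NoHeavyLowerTail` (stmt-CriticalPhenomena-4575) — reflective polynomial arithmetic on LIST-exponent terms (fast under native compilation)

Support file, seat `prim-l12-p5` (gen 9), `--supports stmt-CriticalPhenomena-4575`.  Standard axioms; computable list operations; no sorries.
`…SahiPolyReflect` builds products on terms with `Fin k → ℕ` exponent CLOSURES, which is prohibitively slow in compiled code (one 64×64 product > 700 s);
here the same algebra is done on terms `(c, [e_0,…,e_{k−1}])` with list exponents (`addE`, `mulT`, `pmulK`, `prodK`, `pscaleK`, `sumK`, `sahiPolyK`; one 64×64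
product + sort/merge zero test < 1 s), evaluated by `evalKL` of `…SahiPolyReflectFast`, with a hash-sorted zero test `isZeroK` (sort by `hashL`, merge adjacent
equal exponent lists with the tree's `mergeAdj`).  Soundness: `getD_addE`, `evalKL_mulT`, `evalKL_pmulK`, `evalKL_prodK`, `evalKL_pscaleK`, `evalKL_sumK`,
`evalKL_sahiPolyK`, `evalKL_eq_zero_of_isZeroK`, **`evalKL_eq_of_isZeroK`**; bridge to `Fin k → ℕ` data: the tree's `evalKL_toKL`.
Standard axioms only (no `native_decide` in this file; users run `isZeroK` by `native_decide` in `--computational` files). [this work; folklore]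
-/

namespace Summit.CriticalPhenomena.PercolationContinuityZ3.Theorems

namespace SahiHitting

open Finset

variable {k : ℕ}

/-! ## Arithmetic on list-exponent terms -/

/-- Pointwise sum of exponent lists (the shorter list is padded). [folklore] -/
def addE : List ℕ → List ℕ → List ℕ
  | [], b => b
  | a, [] => a
  | x :: xs, y :: ys => (x + y) :: addE xs ys

/-- `addE` is pointwise addition for `getD · 0`. [folklore] -/
theorem getD_addE : ∀ (a b : List ℕ) (i : ℕ), (addE a b).getD i 0 = a.getD i 0 + b.getD i 0
  | [], b, i => by simp [addE]
  | x :: xs, [], i => by simp [addE]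
  | x :: xs, y :: ys, 0 => by simp [addE]
  | x :: xs, y :: ys, i + 1 => by simp only [addE, List.getD_cons_succ]; exact getD_addE xs ys i

/-- Product of two terms. [folklore] -/
def mulT (t s : ℤ × List ℕ) : ℤ × List ℕ := (t.1 * s.1, addE t.2 s.2)

/-- Product of two term lists. [folklore] -/
def pmulK : List (ℤ × List ℕ) → List (ℤ × List ℕ) → List (ℤ × List ℕ)
  | [], _ => []
  | t :: ts, M => M.map (mulT t) ++ pmulK ts M

/-- Product of a list of term lists. [folklore] -/
def prodK : List (List (ℤ × List ℕ)) → List (ℤ × List ℕ)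
  | [] => [(1, [])]
  | L :: Ls => pmulK L (prodK Ls)

/-- Scalar multiple. [folklore] -/
def pscaleK (c : ℤ) (L : List (ℤ × List ℕ)) : List (ℤ × List ℕ) := L.map fun t => (c * t.1, t.2)

/-- Negation. [folklore] -/
def pnegK (L : List (ℤ × List ℕ)) : List (ℤ × List ℕ) := pscaleK (-1) L

/-- Sum (concatenation) of a list of term lists. [folklore] -/
def sumK : List (List (ℤ × List ℕ)) → List (ℤ × List ℕ)
  | [] => []
  | L :: Ls => L ++ sumK Ls

/-- The set-partition polynomial `Σ_p c_p ∏_{B∈p} mo(B)` as a term list. [this work] -/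
def sahiPolyK (parts : List (ℤ × List ℕ)) (mo : ℕ → List (ℤ × List ℕ)) : List (ℤ × List ℕ) :=
  sumK (parts.map fun p => pscaleK p.1 (prodK (p.2.map mo)))

/-- Hash of an exponent list (for sorting only). [folklore] -/
def hashL : List ℕ → ℕ
  | [] => 0
  | x :: xs => x + 8 * hashL xs

/-- Zero test: sort by hash, merge adjacent equal exponent lists (`mergeAdj`), all coefficients zero. [folklore] -/
def isZeroK (L : List (ℤ × List ℕ)) : Bool :=
  (mergeAdj (L.mergeSort fun a b => Nat.ble (hashL a.2) (hashL b.2))).all fun t => t.1 == 0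

/-! ## Soundness with respect to `evalKL` -/

/-- The monomial of a term. [folklore] -/
theorem evalKL_cons' (t : ℤ × List ℕ) (L : List (ℤ × List ℕ)) (x : Fin k → ℝ) :
    evalKL k (t :: L) x = (t.1 : ℝ) * (∏ i : Fin k, x i ^ t.2.getD i.1 0) + evalKL k L x := by
  simp [evalKL]

/-- `evalKL` of a concatenation. [folklore] -/
theorem evalKL_append (L M : List (ℤ × List ℕ)) (x : Fin k → ℝ) : evalKL k (L ++ M) x = evalKL k L x + evalKL k M x := by
  simp [evalKL, List.map_append, List.sum_append]

/-- Soundness of `mulT`. [folklore] -/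
theorem evalKL_mulT (t s : ℤ × List ℕ) (x : Fin k → ℝ) :
    ((mulT t s).1 : ℝ) * (∏ i : Fin k, x i ^ (mulT t s).2.getD i.1 0)
      = ((t.1 : ℝ) * ∏ i : Fin k, x i ^ t.2.getD i.1 0) * ((s.1 : ℝ) * ∏ i : Fin k, x i ^ s.2.getD i.1 0) := by
  have hp : (∏ i : Fin k, x i ^ (addE t.2 s.2).getD i.1 0) = (∏ i : Fin k, x i ^ t.2.getD i.1 0) * ∏ i : Fin k, x i ^ s.2.getD i.1 0 := by
    rw [← Finset.prod_mul_distrib]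
    exact Finset.prod_congr rfl fun i _ => by rw [getD_addE, pow_add]
  simp only [mulT]
  push_cast
  rw [hp]; ring

/-- Soundness of the `map (mulT t)` step. [folklore] -/
theorem evalKL_map_mulT (t : ℤ × List ℕ) (M : List (ℤ × List ℕ)) (x : Fin k → ℝ) :
    evalKL k (M.map (mulT t)) x = ((t.1 : ℝ) * ∏ i : Fin k, x i ^ t.2.getD i.1 0) * evalKL k M x := by
  induction M with
  | nil => simp [evalKL]
  | cons s ss ih => rw [List.map_cons, evalKL_cons', evalKL_cons', ih, evalKL_mulT]; ring

/-- Soundness of `pmulK`. [folklore] -/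
theorem evalKL_pmulK (L M : List (ℤ × List ℕ)) (x : Fin k → ℝ) : evalKL k (pmulK L M) x = evalKL k L x * evalKL k M x := by
  induction L with
  | nil => simp [pmulK, evalKL]
  | cons t ts ih => rw [pmulK, evalKL_append, evalKL_map_mulT, ih, evalKL_cons']; ring

/-- Soundness of `prodK`. [folklore] -/
theorem evalKL_prodK (Ls : List (List (ℤ × List ℕ))) (x : Fin k → ℝ) : evalKL k (prodK Ls) x = (Ls.map fun L => evalKL k L x).prod := by
  induction Ls with
  | nil => simp [prodK, evalKL]
  | cons L Ls ih => rw [prodK, evalKL_pmulK, ih, List.map_cons, List.prod_cons]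

/-- Soundness of `pscaleK`. [folklore] -/
theorem evalKL_pscaleK (c : ℤ) (L : List (ℤ × List ℕ)) (x : Fin k → ℝ) : evalKL k (pscaleK c L) x = (c : ℝ) * evalKL k L x := by
  induction L with
  | nil => simp [pscaleK, evalKL]
  | cons t ts ih =>
    simp only [pscaleK, List.map_cons] at ih ⊢
    rw [evalKL_cons', evalKL_cons', ih]; push_cast; ring

/-- Soundness of `pnegK`. [folklore] -/
theorem evalKL_pnegK (L : List (ℤ × List ℕ)) (x : Fin k → ℝ) : evalKL k (pnegK L) x = -evalKL k L x := by
  rw [pnegK, evalKL_pscaleK]; push_cast; ring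

/-- Soundness of `sumK`. [folklore] -/
theorem evalKL_sumK (Ls : List (List (ℤ × List ℕ))) (x : Fin k → ℝ) : evalKL k (sumK Ls) x = (Ls.map fun L => evalKL k L x).sum := by
  induction Ls with
  | nil => simp [sumK, evalKL]
  | cons L Ls ih => rw [sumK, evalKL_append, ih, List.map_cons, List.sum_cons]

/-- Soundness of `sahiPolyK`. [this work] -/
theorem evalKL_sahiPolyK (parts : List (ℤ × List ℕ)) (mo : ℕ → List (ℤ × List ℕ)) (x : Fin k → ℝ) :
    evalKL k (sahiPolyK parts mo) x = (parts.map fun p => (p.1 : ℝ) * (p.2.map fun B => evalKL k (mo B) x).prod).sum := by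
  rw [sahiPolyK, evalKL_sumK, List.map_map]
  congr 1
  refine List.map_congr_left fun p _ => ?_
  simp only [Function.comp, evalKL_pscaleK, evalKL_prodK, List.map_map]
  rfl

/-- A term list all of whose merged coefficients vanish evaluates to `0`. [folklore] -/
theorem evalKL_eq_zero_of_isZeroK (L : List (ℤ × List ℕ)) (h : isZeroK L = true) (x : Fin k → ℝ) : evalKL k L x = 0 := by
  rw [evalKL_perm (List.mergeSort_perm L fun a b => Nat.ble (hashL a.2) (hashL b.2)).symm, ← evalKL_mergeAdj]
  rw [isZeroK, List.all_eq_true] at h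
  generalize hC : mergeAdj (L.mergeSort fun a b => Nat.ble (hashL a.2) (hashL b.2)) = C at h
  clear hC
  unfold evalKL
  induction C with
  | nil => rfl
  | cons t ts ih =>
    have ht : t.1 = 0 := by simpa using h t (by simp)
    rw [List.map_cons, List.sum_cons, ht, ih (fun s hs => h s (by simp [hs]))]
    push_cast; ring

/-- **Reflective identity check (list terms)**: `isZeroK (L ++ pnegK M)` certifies `evalKL L = evalKL M`. [folklore] -/
theorem evalKL_eq_of_isZeroK (L M : List (ℤ × List ℕ)) (h : isZeroK (L ++ pnegK M) = true) (x : Fin k → ℝ) :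
    evalKL k L x = evalKL k M x := by
  have h0 := evalKL_eq_zero_of_isZeroK _ h x
  rw [evalKL_append, evalKL_pnegK] at h0
  linarith

end SahiHitting

end Summit.CriticalPhenomena.PercolationContinuityZ3.Theorems
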